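import Literature.AlgebraicGeometry.HodgeTheory.WeightedPencilLocalisation
import Literature.AlgebraicGeometry.HodgeTheory.WeightedPencilLocalisationPackage
import Literature.AlgebraicGeometry.HodgeTheory.WeightedPencilFoldIsotopy
import Literature.AlgebraicGeometry.HodgeTheory.NodalPencilPicardLefschetz
import HarnessLib

/-!
# The localised geometric monodromy of a monomial pencil around a member with ONE isolated singular point of
# Pham–Brieskorn type (arbitrary weights): the H-A3LOC package from a normal-form chart

Family `hodge`, layer `Literature/AlgebraicGeometry/HodgeTheory`; theorems only (no definition, no named fact). Written by the
prover seat `hodge-nonav-20241-p1` (g19, cell `hodge-nonav`) as brick 8 of the port B4c of the programme «A₃-TRACE» (memo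
`HOME/memos/PROGRAMME-A3-TRACE-Bx-g16.md` §3; binder hN `stub_a3NonCommOdd` of crux K1-B `VeryGeneralSignCommutatorsInHg`,
`Summits/HodgeConjecture/HodgeConjecture/Theses/SignSymmetricPowers.lean`, stmt-HodgeConjecture-19716): the WEIGHTED twin of the leaf
`NodalPencilPicardLefschetz.picardLefschetz_oneNode_monomial` of prover-Bx's ODP-ISOTOPY port, with

* the Morse chart REPLACED by a hypothesis: a `C^∞` chart `Θ` of the affine chart `xᵢ = 1` centred at the
  singular point `[p]` (`Θ(y₀) = 0`, `y₀ = (p_{i.succAbove l}/pᵢ)_l`) in which the pencil coordinate is in Pham–Brieskorn normal form,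
  `Σ_l (Θ y)_l^{a_l} = −f₁(ins_i 1 y)` (weights `a_l ≠ 0`; at a node `a = 2`, `OrdinaryDoublePointMorseChart`; at an `A₃` point
  `a = (2, …, 2, 4)`, prover-Bx's B4a `SymmetricA3NormalFormChart`);
* the shell submersion as a UNIFORM hypothesis `hsubU` (for all shells `s₀² ≤ Σ|Θ y|² ≤ r₂²` with `r₂ < rmax` there is `δ > 0`
  such that `(φ, Σ|Θ ·|²)` has onto differential where `|φ| ≤ δ`; discharged by `QuadricPencilShellSubmersion` resp. prover-Bx's B4b
  `SuspendedNodePencilShellSubmersion`);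
* the singular member: `[p]` (`pᵢ ≠ 0`) is the ONLY singular point of `f₁` (`hsing`), and the nearby members `f₁ + c'·(a₀ xᵢ^d)`,
  `0 < |c'| < ε₁`, are nonsingular (`hns₁`; at an `A₃` point this is the bifurcation clause at `a′ = 0`);

and with the Picard–Lefschetz socket REPLACED by the localisation package (`WeightedPencilLocalisationPackage`). All constants of the
classical construction (radii, bumps, coefficient fields `e`, `i·e`, Lipschitz bounds, the chart of the regular locus, the disc radius)
are CHOSEN here exactly as in the nodal leaf; the bricks run are `WeightedPencilFoldIsotopy` → `WeightedPencilMonodromyMap` →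
`WeightedPencilLocalisation` → `WeightedPencilLocalisationPackage`.

* `hypersurfacePoint_eq_mk_of_singular_of_unique`, `exists_coeff_nhds_singular_subset_nodeNbhd_of_unique` — the fibre-singular
  points over a neighbourhood of `coeffs f₁` lie in the node neighbourhood `N_η(y₀)` (twin of the uninodal statements of
  `NodalPencilCutoffFlows` §2 for a form with a unique, arbitrary, singular point);
* **`exists_localisationPackage_of_chart`** — there is `ε₀ > 0` (`≤ ε₁`) such that for every `0 < ε < ε₀`, every base point `s'`
  of form `f₁ + ε·(a₀ xᵢ^d)` and every pencil circle `γ` of radius `ε` at `s'`: opens `A' ∪ B' = Y_{s'}(ℂ)`, a homeomorphism `η` of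
  `Y_{s'}(ℂ)` equal to the identity on `B'` and preserving `A'` (restriction `ηA`), a chart `e' : A' → {Σ z_l^{a_l} = 1}` BIJECTIVE on
  every `H_k(·; M)`, the inverse weighted rotation `g = R_{−2π} : z_l ↦ e^{−2πi/a_l} z_l` with `e' ∘ ηA ≃ g ∘ e'`, and **every rational
  transport along `γ`, in every degree, equals `η^*`**.

Everything is proved; no definitions, no named facts. HONEST SCOPE: the chart, the shell submersion and the nonsingularity of the nearby
members are hypotheses; nothing here says HC or any rung is proved.

## References

* [VoisinHodgeII2003] C. Voisin, Hodge Theory and Complex Algebraic Geometry II (2003), §3.1.2, §3.2.1 Thm. 3.16; §2.3.1–§2.3.3; §6.2.1.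
* [ArnoldGuseinzadeVarchenko2012] V. I. Arnold, S. M. Gusein-Zade, A. N. Varchenko, Singularities of Differentiable Maps II (2012),
  Part I §1.1–§1.3, §2.1, §2.3.
* [Milnor1968] J. Milnor, Singular Points of Complex Hypersurfaces, §9 (Lemma 9.4, Thm. 9.1).
* [Lamotke1981] K. Lamotke, The topology of complex projective varieties after S. Lefschetz, Topology 20 (1981), §5–§6.
-/

noncomputable section

open CategoryTheory AlgebraicGeometry MvPolynomial TopologicalSpace Set Topology Filter Complex Metric
open scoped Manifold ContDiff Real unitInterval
open Literature.AlgebraicGeometry.Motives Literature.AlgebraicGeometry.Motives.UniversalHypersurface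
open Literature.AlgebraicGeometry.HodgeTheory.UniversalHypersurface Literature.Geometry.ComplexAnalytic Literature.Geometry.Manifold
open Literature.AlgebraicTopology.SingularHomology Literature.NumberTheory.Transcendental

namespace Literature.AlgebraicGeometry.HodgeTheory

namespace WeightedPencil

/-! ### The singular points over the coefficient vector of a form with a unique singular point -/

/-- **A fibre-singular point of `𝒴(ℂ)` over the coefficient vector of a form with a unique singular point is that point**: if `F` is
homogeneous of degree `d`, every non-zero `z` killing all `∂_l F` is a multiple of `p ≠ 0`, `P ∉ 𝒴°(ℂ)` and `b(P) = coeffs F`, then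
`[z](P) = [p]`. [cite: VoisinHodgeII2003, §2.3.1] -/
theorem hypersurfacePoint_eq_mk_of_singular_of_unique {n d : ℕ} {F : MvPolynomial (Fin (n + 2)) ℂ} (hF : F.IsHomogeneous d)
    {p : Fin (n + 2) → ℂ} (hp0 : p ≠ 0)
    (hsing : ∀ z : Fin (n + 2) → ℂ, z ≠ 0 → (∀ l, eval z (pderiv l F) = 0) → ∃ t : ℂ, z = t • p)
    {P : ComplexPoints (totalSpaceOver ℂ n d)}
    (hP : P ∉ Set.range (AlgPoints.map (regularToTotalSpaceOver ℂ n d) :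
      ComplexPoints (regularTotal ℂ n d) → ComplexPoints (totalSpaceOver ℂ n d)))
    (hb : tCoeff ℂ n d P = coeffsOf n d F) :
    hypersurfacePoint (totalOverToProjectiveSpace ℂ n d) P = Projectivization.mk ℂ p hp0 := by
  have htForm : tForm ℂ n d P = F := by
    rw [tForm_eq_formOfCoeffs, hb]
    exact formOfCoeffs_coeffsOf n d hF
  rw [mem_range_map_regularToTotalSpaceOver_iff, not_exists] at hP
  set z := (hypersurfacePoint (totalOverToProjectiveSpace ℂ n d) P).rep with hzdef
  have hz0 : z ≠ 0 := (hypersurfacePoint (totalOverToProjectiveSpace ℂ n d) P).rep_nonzero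
  have hmk : Projectivization.mk ℂ z hz0 = hypersurfacePoint (totalOverToProjectiveSpace ℂ n d) P := Projectivization.mk_rep _
  have hpart : ∀ l : Fin (n + 2), eval z (pderiv l F) = 0 := by
    intro l
    have hl := hP l
    rw [not_not, htForm, ← hmk, Projectivization.mem_projZeroLocus_mk_iff (by
      rintro G rfl
      by_cases h0 : pderiv l F = 0
      · rw [h0]; exact MvPolynomial.isHomogeneous_zero _ _ _
      · rw [(hF.pderiv (i := l)).totalDegree h0]; exact hF.pderiv)] at hl
    simpa using hl
  obtain ⟨t, hzt⟩ := hsing z hz0 hpart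
  have ht : t ≠ 0 := by
    rintro rfl
    exact hz0 (by rw [hzt, zero_smul])
  rw [← hmk, Projectivization.mk_eq_mk_iff]
  exact ⟨Units.mk0 t ht, by rw [hzt]; rfl⟩

/-- **An open `V ∋ coeffs F` over which every fibre-singular point lies in `N_η(y₀)`**, for a form `F` of degree `d` whose unique
singular point `[p]` has `p i ≠ 0` and affine coordinates `y₀` (`η > 0`). [cite: VoisinHodgeII2003, §2.3.1 and §2.3.2] -/
theorem exists_coeff_nhds_singular_subset_nodeNbhd_of_unique (n d : ℕ) (i : Fin (n + 2)) (y₀ : Fin (n + 1) → ℂ) {η : ℝ}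
    (hη : 0 < η) {F : MvPolynomial (Fin (n + 2)) ℂ} (hF : F.IsHomogeneous d) {p : Fin (n + 2) → ℂ} (hp0 : p ≠ 0)
    (hsing : ∀ z : Fin (n + 2) → ℂ, z ≠ 0 → (∀ l, eval z (pderiv l F) = 0) → ∃ t : ℂ, z = t • p) (hpi : p i ≠ 0)
    (hy₀ : y₀ = fun j => p (i.succAbove j) / p i) :
    ∃ V : Set (DegIndex n d → ℂ), IsOpen V ∧ coeffsOf n d F ∈ V ∧
      ∀ P : ComplexPoints (totalSpaceOver ℂ n d),
        P ∉ Set.range (AlgPoints.map (regularToTotalSpaceOver ℂ n d) : ComplexPoints (regularTotal ℂ n d) → _) →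
          tCoeff ℂ n d P ∈ V → P ∈ NodalPencil.nodeNbhd n d i y₀ η :=
  exists_open_nhds_singular_subset n d (NodalPencil.isOpen_nodeNbhd n d i y₀ η) fun _ hP hPb =>
    NodalPencil.mem_nodeNbhd_of_hypersurfacePoint_eq_mk n d i y₀ η hη hp0 hpi hy₀
      (hypersurfacePoint_eq_mk_of_singular_of_unique hF hp0 hsing hP hPb)

/-! ### The package -/

set_option maxHeartbeats 1600000 in
/-- **The localisation package of the geometric monodromy of the pencil `f₁ + c·(a₀ xᵢ^d)` around its singular member, from a
normal-form chart** (see the module docstring for the hypotheses and the conclusion).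
[cite: VoisinHodgeII2003, §3.1.2 and §3.2.1 Thm. 3.16] [cite: ArnoldGuseinzadeVarchenko2012, Part I §1.3, §2.1 and §2.3]
[cite: Milnor1968, §9 Lemma 9.4 and Thm. 9.1] [cite: Lamotke1981, §6] -/
theorem exists_localisationPackage_of_chart {n d : ℕ} (hn : 1 ≤ n) (hd : 1 ≤ d) {f₁ : MvPolynomial (Fin (n + 2)) ℂ}
    (hf₁ : f₁.IsHomogeneous d) {p : Fin (n + 2) → ℂ} (hp0 : p ≠ 0)
    (hsing : ∀ z : Fin (n + 2) → ℂ, z ≠ 0 → (∀ l, eval z (pderiv l f₁) = 0) → ∃ t : ℂ, z = t • p)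
    (i : Fin (n + 2)) (hpi : p i ≠ 0) {a₀ : ℂ} (ha₀ : a₀ ≠ 0) {ε₁ : ℝ} (hε₁ : 0 < ε₁)
    (hns₁ : ∀ c' : ℂ, c' ≠ 0 → ‖c'‖ < ε₁ →
      SmoothHypersurface.IsNonsingularForm ℂ (f₁ + c' • (a₀ • X i ^ d : MvPolynomial (Fin (n + 2)) ℂ)))
    (a : Fin (n + 1) → ℕ) (ha : ∀ l, a l ≠ 0)
    (Θ : OpenPartialHomeomorph (Fin (n + 1) → ℂ) (Fin (n + 1) → ℂ))
    (hy₀s : (fun l => p (i.succAbove l) / p i) ∈ Θ.source) (hΘ0 : Θ (fun l => p (i.succAbove l) / p i) = 0)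
    (hΘ : ContDiffOn ℝ ∞ Θ Θ.source)
    (hΘφ : ∀ y ∈ Θ.source, ∑ l, (Θ y l) ^ a l = -eval (Fin.insertNth i (1 : ℂ) y : Fin (n + 2) → ℂ) f₁)
    {rmax : ℝ} (hrmax : 0 < rmax)
    (hsubU : ∀ s₀ r₂ : ℝ, 0 < s₀ → s₀ ≤ r₂ → r₂ < rmax → ∃ δ : ℝ, 0 < δ ∧
      ∀ y ∈ Θ.source, s₀ ^ 2 ≤ ∑ l, ‖Θ y l‖ ^ 2 → ∑ l, ‖Θ y l‖ ^ 2 ≤ r₂ ^ 2 →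
        ‖-eval (Fin.insertNth i (1 : ℂ) y : Fin (n + 2) → ℂ) f₁‖ ≤ δ →
        Function.Surjective (fderiv ℝ (fun y' : Fin (n + 1) → ℂ =>
          ((-eval (Fin.insertNth i (1 : ℂ) y' : Fin (n + 2) → ℂ) f₁ : ℂ), (∑ l, ‖Θ y' l‖ ^ 2 : ℝ))) y)) :
    ∃ ε₀ : ℝ, 0 < ε₀ ∧ ε₀ ≤ ε₁ ∧
      ∀ (ε : ℝ), 0 < ε → ε < ε₀ →
        ∀ (s' : ComplexPoints (base ℂ n d)), pointForm ℂ n d s' = f₁ + (ε : ℂ) • (a₀ • X i ^ d) →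
          ∀ (γ : Path s' s'), IsPencilCircle n d f₁ (a₀ • X i ^ d) ε γ →
            ∃ (A' B' : Set (ComplexPoints (fiberOver (family ℂ n d) s'))), IsOpen A' ∧ IsOpen B' ∧ A' ∪ B' = Set.univ ∧
              ∃ (η : ComplexPoints (fiberOver (family ℂ n d) s') ≃ₜ ComplexPoints (fiberOver (family ℂ n d) s'))
                (ηA : C(↥A', ↥A')) (e' : C(↥A', ↥(PhamBrieskorn.fibre a)))
                (g : C(↥(PhamBrieskorn.fibre a), ↥(PhamBrieskorn.fibre a))),
                (∀ y ∈ B', η y = y) ∧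
                (∀ x : ↥A', ((ηA x : ↥A') : ComplexPoints (fiberOver (family ℂ n d) s')) = η x) ∧
                (∀ (R M : Type) [CommRing R] [AddCommGroup M] [Module R M] (k' : ℕ),
                  Function.Bijective (singularHomology.map R M e' k').hom) ∧
                (∀ z, ((g z : ↥(PhamBrieskorn.fibre a)) : Fin (n + 1) → ℂ) =
                  fun l => Complex.exp ((((-(2 * π)) / a l : ℝ) : ℂ) * Complex.I) * (z : Fin (n + 1) → ℂ) l) ∧
                (e'.comp ηA).Homotopic (g.comp e') ∧
                ∀ (hU : IsCohomologicallyLocallyTrivialOn (family ℂ n d) Set.univ) (k' : ℕ)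
                  (T : bettiCohomology (fiberOver (family ℂ n d) s') k' ≃ₗ[ℚ] bettiCohomology (fiberOver (family ℂ n d) s') k'),
                  IsRatTransport (family ℂ n d) k' hU (loopClassUniv n d γ) T →
                    ∀ x, T x = (singularCohomology.map ℚ ℚ
                      (η : C(ComplexPoints (fiberOver (family ℂ n d) s'), ComplexPoints (fiberOver (family ℂ n d) s')))
                        k').hom x := by
  classical
  have hd' : 0 < d := hd
  set b₀ : DegIndex n d → ℂ := coeffsOf n d f₁ with hb₀
  set m₀ : DegIndex n d := regPowIndex n d i with hm₀
  set y₀ : Fin (n + 1) → ℂ := fun l => p (i.succAbove l) / p i with hy₀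
  haveI : T2Space (ComplexPoints (regularTotal ℂ n d)) := t2Space_regularTotal n d
  ------------------------------------------------------------------
  -- (1) the pencil coordinate `φ`
  ------------------------------------------------------------------
  set φ : (Fin (n + 1) → ℂ) → ℂ := fun y => -MvPolynomial.eval (Fin.insertNth i (1 : ℂ) y : Fin (n + 2) → ℂ) f₁ with hφ_def
  have hφ : ∀ y, φ y = regChartCoeffVec n d i
      (Sum.elim (fun m : {m : DegIndex n d // m ≠ regPowIndex n d i} => b₀ m.1) y) (regPowIndex n d i) - b₀ (regPowIndex n d i) := by
    intro y
    rw [hb₀, regChartCoeffVec_pencil_regPowIndex_of_isHomogeneous n d i hf₁, coeffsOf_apply]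
    change -_ = MvPolynomial.coeff (Finsupp.single i d) f₁ - _ - MvPolynomial.coeff (Finsupp.single i d) f₁
    ring
  have hΘφ' : ∀ y ∈ Θ.source, ∑ l, (Θ y l) ^ a l = φ y := fun y hy => hΘφ y hy
  have hφc : Continuous φ :=
    ((MvPolynomial.continuous_eval f₁).comp
      (Continuous.finInsertNth (A := fun _ : Fin (n + 2) => ℂ) i continuous_const continuous_id)).neg
  ------------------------------------------------------------------
  -- (2) the radii and the shell submersion
  ------------------------------------------------------------------
  obtain ⟨ρ, hρ, hρt⟩ := Metric.isOpen_iff.mp Θ.open_target 0 (by rw [← hΘ0]; exact Θ.map_source hy₀s)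
  set r : ℝ := ρ / 2 with hr_def
  have hr0 : 0 < r := by positivity
  have hrt : {z : Fin (n + 1) → ℂ | ∑ j, ‖z j‖ ^ 2 ≤ r ^ 2} ⊆ Θ.target := by
    intro z hz
    refine hρt (mem_ball_zero_iff.mpr ((pi_norm_lt_iff hρ).mpr fun j => ?_))
    have hj : ‖z j‖ ^ 2 ≤ r ^ 2 :=
      le_trans (Finset.single_le_sum (fun j _ => sq_nonneg ‖z j‖) (Finset.mem_univ j)) hz
    have : ‖z j‖ ≤ r := le_of_sq_le_sq hj hr0.le
    linarith
  set R'' : ℝ := r ^ 2 with hR''_def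
  have hR''t : {z : Fin (n + 1) → ℂ | ∑ j, ‖z j‖ ^ 2 ≤ R''} ⊆ Θ.target := hrt
  set R''' : ℝ := r ^ 2 / 2 with hR'''_def
  have hR : R''' < R'' := by rw [hR'''_def, hR''_def]; nlinarith
  have hR'''0 : 0 < R''' := by positivity
  set r₂ : ℝ := min (min (1 / 2) (R''' / 2)) (rmax / 2) with hr₂_def
  have hr₂0 : 0 < r₂ := by positivity
  have hr₂h : r₂ ≤ 1 / 2 := (min_le_left _ _).trans (min_le_left _ _)
  have hr₂R : r₂ ≤ R''' / 2 := (min_le_left _ _).trans (min_le_right _ _)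
  have hr₂max : r₂ < rmax := lt_of_le_of_lt (min_le_right _ _) (by linarith)
  have hr₂sq : r₂ ^ 2 < R''' := by nlinarith
  set s₁ : ℝ := r₂ / 2 with hs₁_def
  set s₀ : ℝ := r₂ / 4 with hs₀_def
  have hs₀ : 0 < s₀ := by positivity
  have hs₀₁ : s₀ ^ 2 < s₁ ^ 2 := by rw [hs₀_def, hs₁_def]; nlinarith
  have hs₁r : s₁ ^ 2 < r₂ ^ 2 := by rw [hs₁_def]; nlinarith
  set T : ℝ := r₂ ^ 2 with hT_def
  set T' : ℝ := r₂ ^ 2 / 2 with hT'_def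
  set t₁ : ℝ := s₁ ^ 2 with ht₁_def
  set t₂ : ℝ := 3 * r₂ ^ 2 / 8 with ht₂_def
  have hT0 : 0 < T := by positivity
  have hT'0 : 0 < T' := by positivity
  have hTR : T ≤ R''' := hr₂sq.le
  have hTr : T ≤ r ^ 2 := by rw [hT_def]; linarith
  have hTr₂ : T ≤ r₂ ^ 2 := le_rfl
  have ht₁ : s₁ ^ 2 ≤ t₁ := le_rfl
  have ht₁₂ : t₁ < t₂ := by rw [ht₁_def, ht₂_def, hs₁_def]; nlinarith
  have ht₂T' : t₂ < T' := by rw [ht₂_def, hT'_def]; nlinarith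
  have hT'T : T' < T := by rw [hT'_def, hT_def]; nlinarith
  obtain ⟨δ, hδ0, hsub⟩ := hsubU s₀ r₂ hs₀ (by rw [hs₀_def]; linarith) hr₂max
  ------------------------------------------------------------------
  -- (3) the cut-off `β` at the singular point (centred at `y₀`)
  ------------------------------------------------------------------
  have hUo : IsOpen (Θ.source ∩ {x | ∑ j, ‖Θ x j‖ ^ 2 < s₀ ^ 2}) := PhamBrieskorn.isOpen_chartBall Θ
  have hy₀U : y₀ ∈ Θ.source ∩ {x | ∑ j, ‖Θ x j‖ ^ 2 < s₀ ^ 2} :=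
    ⟨hy₀s, by rw [mem_setOf_eq, hΘ0]; simp [pow_pos hs₀ 2]⟩
  obtain ⟨η₀, hη₀, hη₀U⟩ := Metric.isOpen_iff.mp hUo y₀ hy₀U
  set η : ℝ := η₀ / 3 with hη_def
  have hη : 0 < η := by positivity
  let β : ContDiffBump y₀ := ⟨η, 2 * η, hη, by linarith⟩
  have hβ : ContDiff ℝ ∞ β := β.contDiff
  have hβR : ∀ y : Fin (n + 1) → ℂ, 2 * η + ‖y₀‖ < ‖y‖ → β y = 0 := fun y hy =>
    β.zero_of_le_dist (by
      rw [dist_eq_norm]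
      have := norm_sub_norm_le y y₀
      linarith)
  have hβ1 : ∀ y : Fin (n + 1) → ℂ, ‖y - y₀‖ < η → β y = 1 := fun y hy =>
    β.one_of_mem_closedBall (by rw [mem_closedBall, dist_eq_norm]; exact hy.le)
  have hβs : ∀ y : Fin (n + 1) → ℂ, β y ≠ 0 → y ∈ Θ.source ∧ ∑ j, ‖Θ y j‖ ^ 2 < s₀ ^ 2 := by
    intro y hy
    have hmem : y ∈ Function.support (β : (Fin (n + 1) → ℂ) → ℝ) := hy
    rw [β.support_eq] at hmem
    have hyball : y ∈ ball y₀ η₀ := by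
      rw [mem_ball] at hmem ⊢
      change dist y y₀ < 2 * η at hmem
      linarith
    exact hη₀U hyball
  ------------------------------------------------------------------
  -- (4) the base cut-off `χ`, the nonsingularity radius, the base fields
  ------------------------------------------------------------------
  obtain ⟨V, hVo, hb₀V, hV⟩ := exists_coeff_nhds_singular_subset_nodeNbhd_of_unique n d i y₀ hη hf₁ hp0 hsing hpi rfl
  obtain ⟨ρV, hρV, hρVV⟩ := Metric.isOpen_iff.mp hVo b₀ hb₀V
  set ρK : ℝ := min (ρV / 2) δ with hρK_def
  have hρK0 : 0 < ρK := by positivity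
  have hρδ : ρK ≤ δ := min_le_right _ _
  set K : Set (DegIndex n d → ℂ) := closedBall b₀ ρK with hK_def
  have hK : IsCompact K := isCompact_closedBall _ _
  have hKV : K ⊆ V := (closedBall_subset_ball (by
    rw [hρK_def]; exact lt_of_le_of_lt (min_le_left _ _) (by linarith))).trans hρVV
  let χ : ContDiffBump b₀ := ⟨ρK / 2, ρK, by positivity, by linarith⟩
  have hχ : ContDiff ℝ ∞ χ := χ.contDiff
  have hχK0 : ∀ b, b ∉ K → χ b = 0 := fun b hb =>
    χ.zero_of_le_dist (by rw [hK_def, mem_closedBall] at hb; exact (not_le.mp hb).le)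
  have hχK : ∀ b, χ b ≠ 0 → ‖b - b₀‖ < ρK := by
    intro b hb
    have hmem : b ∈ Function.support (χ : (DegIndex n d → ℂ) → ℝ) := hb
    rw [χ.support_eq, mem_ball, dist_eq_norm] at hmem
    exact hmem
  -- nonsingularity in terms of the coefficient `c = c' a₀` of `xᵢ^d`
  have hns₂ : ∀ c : ℂ, c ≠ 0 → ‖c‖ < ε₁ * ‖a₀‖ →
      SmoothHypersurface.IsNonsingularForm ℂ (formOfCoeffs (b₀ + Pi.single m₀ c)) := by
    intro c hc0 hc
    rw [hb₀, hm₀, NodalPencil.formOfCoeffs_coeffsOf_add_single i hf₁]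
    have heq : f₁ + c • X i ^ d = f₁ + (c / a₀) • (a₀ • X i ^ d : MvPolynomial (Fin (n + 2)) ℂ) := by
      rw [smul_smul, div_mul_cancel₀ c ha₀]
    rw [heq]
    refine hns₁ (c / a₀) (div_ne_zero hc0 ha₀) ?_
    rw [norm_div, div_lt_iff₀ (norm_pos_iff.mpr ha₀)]; exact hc
  set ρW : ℝ := min (ρK / 2) (ε₁ * ‖a₀‖) with hρW_def
  have hρW : 0 < ρW := lt_min (by positivity) (mul_pos hε₁ (norm_pos_iff.mpr ha₀))
  have hχ1 : ∀ b, ‖b - b₀‖ < ρW → χ b = 1 := fun b hb =>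
    χ.one_of_mem_closedBall (by
      rw [mem_closedBall, dist_eq_norm]
      exact (hb.trans_le (min_le_left _ _)).le)
  have hns : ∀ c : ℂ, c ≠ 0 → ‖c‖ < ρW →
      SmoothHypersurface.IsNonsingularForm ℂ (formOfCoeffs (b₀ + Pi.single m₀ c)) :=
    fun c hc0 hc => hns₂ c hc0 (hc.trans_le (min_le_right _ _))
  let W₁ : (DegIndex n d → ℂ) → (DegIndex n d → ℂ) := fun _ => Pi.single m₀ 1
  let W₂ : (DegIndex n d → ℂ) → (DegIndex n d → ℂ) := fun _ => Pi.single m₀ Complex.I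
  have hW₁ : ContDiff ℝ ∞ W₁ := contDiff_const
  have hW₂ : ContDiff ℝ ∞ W₂ := contDiff_const
  have hW₁' : ∀ b (m : DegIndex n d), m ≠ m₀ → W₁ b m = 0 := fun b m hm => Pi.single_eq_of_ne hm _
  have hW₂' : ∀ b (m : DegIndex n d), m ≠ m₀ → W₂ b m = 0 := fun b m hm => Pi.single_eq_of_ne hm _
  have hW₁u : ∀ b, ‖b - b₀‖ < ρW → W₁ b m₀ = 1 := fun b _ => Pi.single_eq_same _ _
  have hW₂u : ∀ b, ‖b - b₀‖ < ρW → W₂ b m₀ = Complex.I := fun b _ => Pi.single_eq_same _ _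
  -- Lipschitz bounds for `v_w(z) = χ(b₀ + z e_{m₀}) · w`
  obtain ⟨Cχ, hCχ⟩ := ContDiff.lipschitzWith_of_hasCompactSupport (𝕂 := ℝ) (n := 1) χ.hasCompactSupport χ.contDiff one_ne_zero
  have hA : LipschitzWith ‖(ContinuousLinearMap.single ℝ (fun _ : DegIndex n d => ℂ) m₀ : ℂ →L[ℝ] (DegIndex n d → ℂ))‖₊
      (fun z : ℂ => b₀ + Pi.single m₀ z) := by
    have h := (ContinuousLinearMap.single ℝ (fun _ : DegIndex n d => ℂ) m₀).lipschitz
    have h2 := (LipschitzWith.const (α := ℂ) b₀).add h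
    simpa using h2
  have hLw : ∀ w : ℂ, LipschitzWith ‖((ContinuousLinearMap.id ℝ ℝ).smulRight w : ℝ →L[ℝ] ℂ)‖₊ fun x : ℝ => x • w := fun w =>
    ((ContinuousLinearMap.id ℝ ℝ).smulRight w).lipschitz
  have hv : ∀ w : ℂ, ∃ Kw : NNReal, LipschitzWith Kw (fun z : ℂ => (χ (b₀ + Pi.single m₀ z)) • w) := fun w =>
    ⟨_, ((hLw w).comp hCχ).comp hA⟩
  obtain ⟨K₁, hK₁⟩ := hv 1
  obtain ⟨K₂, hK₂⟩ := hv Complex.I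
  have hv₁ : LipschitzWith K₁ (fun z : ℂ => (χ (b₀ + Pi.single m₀ z) : ℂ) * W₁ (b₀ + Pi.single m₀ z) m₀) := by
    have heq : (fun z : ℂ => (χ (b₀ + Pi.single m₀ z) : ℂ) * W₁ (b₀ + Pi.single m₀ z) m₀) =
        fun z : ℂ => (χ (b₀ + Pi.single m₀ z)) • (1 : ℂ) := by
      funext z; simp [W₁, Complex.real_smul]
    rw [heq]; exact hK₁
  have hv₂ : LipschitzWith K₂ (fun z : ℂ => (χ (b₀ + Pi.single m₀ z) : ℂ) * W₂ (b₀ + Pi.single m₀ z) m₀) := by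
    have heq : (fun z : ℂ => (χ (b₀ + Pi.single m₀ z) : ℂ) * W₂ (b₀ + Pi.single m₀ z) m₀) =
        fun z : ℂ => (χ (b₀ + Pi.single m₀ z)) • Complex.I := by
      funext z; simp [W₂, Complex.real_smul]
    rw [heq]; exact hK₂
  ------------------------------------------------------------------
  -- (5) the fold isotopy
  ------------------------------------------------------------------
  have hsub' : ∀ y ∈ Θ.source, s₀ ^ 2 ≤ ∑ j, ‖Θ y j‖ ^ 2 → ∑ j, ‖Θ y j‖ ^ 2 ≤ r₂ ^ 2 → ‖φ y‖ ≤ δ →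
      Function.Surjective (fderiv ℝ (fun y' : Fin (n + 1) → ℂ => ((φ y' : ℂ), (∑ j, ‖Θ y' j‖ ^ 2 : ℝ))) y) :=
    fun y hy h1 h2 h3 => hsub y hy h1 h2 h3
  obtain ⟨gF, hgc, hg0, hg2π, hgO, hgadd, hgS, hgF⟩ := WeightedPencil.exists_pencil_foldIsotopy_invariant hd' b₀ hΘ φ hφc hφ
    hs₀₁ hs₁r hr₂sq hR hR''t hsub' y₀ β hβ hβR hβ1 hβs χ hχ hK hKV hχK0 hV hχK hρδ hχ1 W₁ W₂ hW₁ hW₂ hW₁' hW₂' hW₁u hW₂u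
    hv₁ hv₂
  ------------------------------------------------------------------
  -- (6) the chart of the regular locus
  ------------------------------------------------------------------
  have hne : (regChartDom n d i).Nonempty := by
    -- the point `y = Θ⁻¹(t, 0, …, 0)` of the member `c = t^{a 0}`, `t` small real
    set t : ℝ := min (r / 2) (min (1 / 2) (ρW / 2)) with ht_def
    have ht0 : 0 < t := by positivity
    have htr : t ≤ r / 2 := min_le_left _ _
    have ht1 : t ≤ 1 := ((min_le_right _ _).trans (min_le_left _ _)).trans (by norm_num)
    have htρ : t ≤ ρW / 2 := (min_le_right _ _).trans (min_le_right _ _)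
    let z : Fin (n + 1) → ℂ := Pi.single (0 : Fin (n + 1)) (t : ℂ)
    have hzsum : ∑ j, ‖z j‖ ^ 2 = t ^ 2 := by
      rw [Finset.sum_eq_single (0 : Fin (n + 1)) (fun b _ hb => by simp [z, Pi.single_eq_of_ne hb]) (by simp)]
      simp [z, abs_of_pos ht0]
    have hzsq : ∑ j, (z j) ^ a j = ((t ^ a 0 : ℝ) : ℂ) := by
      rw [Finset.sum_eq_single (0 : Fin (n + 1)) (fun b _ hb => by simp [z, Pi.single_eq_of_ne hb, zero_pow (ha b)]) (by simp)]
      simp [z]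
    have hzt : z ∈ Θ.target := hrt (by change ∑ j, ‖z j‖ ^ 2 ≤ r ^ 2; rw [hzsum]; nlinarith)
    set y := Θ.symm z with hy
    have hys : y ∈ Θ.source := Θ.map_target hzt
    have hφy : φ y = ((t ^ a 0 : ℝ) : ℂ) := by rw [← hΘφ' y hys, hy, Θ.right_inv hzt, hzsq]
    have hta : 0 < t ^ a 0 := pow_pos ht0 _
    have hc0 : (((t ^ a 0 : ℝ)) : ℂ) ≠ 0 := by exact_mod_cast hta.ne'
    have hcρ : ‖((t ^ a 0 : ℝ) : ℂ)‖ < ρW := by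
      rw [Complex.norm_real, Real.norm_eq_abs, abs_of_pos hta]
      have h1 : t ^ a 0 ≤ t := pow_le_of_le_one ht0.le ht1 (ha 0)
      linarith
    have hvns : SmoothHypersurface.IsNonsingularForm ℂ (formOfCoeffs (regChartCoeffVec n d i
        (Sum.elim (fun m : {m : DegIndex n d // m ≠ regPowIndex n d i} => b₀ m.1) y))) := by
      rw [NodalPencil.regChartCoeffVec_slice_eq b₀ φ hφ, hφy]
      exact hns _ hc0 hcρ
    obtain ⟨Q, hQ, -⟩ := exists_regChartFun_eq_of_nonsingular n d i hd' _ hvns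
    exact ⟨Q, hQ⟩
  obtain ⟨Φ, hΦ, hΦs, hΦt, -, -⟩ := exists_regChart (n := n) (d := d) (i := i) hd' hne
  ------------------------------------------------------------------
  -- (7) the disc radius and the monodromy map
  ------------------------------------------------------------------
  set x₀ : ℝ := T' / (2 * (n + 1)) with hx₀_def
  have hx₀0 : 0 < x₀ := by positivity
  have hx₀1 : x₀ ≤ 1 := by
    rw [hx₀_def, div_le_one (by positivity), hT'_def]
    have hn1 : (1 : ℝ) ≤ n + 1 := by norm_cast; omega
    nlinarith
  set δ₀ : ℝ := min (ρW / 4) (x₀ ^ (∑ l, a l)) with hδ₀_def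
  have hδ₀0 : 0 < δ₀ := by positivity
  have hδ₀W : δ₀ ≤ ρW / 4 := min_le_left _ _
  have hδ₀x : δ₀ ≤ x₀ ^ (∑ l, a l) := min_le_right _ _
  have hδρ : δ₀ ≤ ρW := by linarith
  obtain ⟨h, k, H, hhc, hh0, hhk, hh1, hHc, hH⟩ := WeightedPencil.exists_pencil_monodromyMap a ha hd' b₀ Φ hΦ hΦs hΦt Θ hrt φ hφ
    hΘφ' hρW hns hR hTR hTr hT0 gF hgc hg0 hg2π hgO hgadd hgS hgF hs₀₁ hTr₂ hδ₀W hΘ hR''t ht₁ ht₁₂ ht₂T'.le hT'T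
  ------------------------------------------------------------------
  -- (8) `ε₀` and the data of a member
  ------------------------------------------------------------------
  refine ⟨min ε₁ (δ₀ / ‖a₀‖), lt_min hε₁ (div_pos hδ₀0 (norm_pos_iff.mpr ha₀)), min_le_left _ _, ?_⟩
  intro ε hε hεε₀ s' hs' γ hγ
  -- the coefficient `c = ε a₀` of `xᵢ^d`
  set c : ℂ := (ε : ℂ) * a₀ with hc_def
  have hc0 : c ≠ 0 := mul_ne_zero (by exact_mod_cast hε.ne') ha₀
  have hcδ : ‖c‖ < δ₀ := by
    rw [hc_def, norm_mul, Complex.norm_real, Real.norm_eq_abs, abs_of_pos hε]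
    have h1 : ε < δ₀ / ‖a₀‖ := hεε₀.trans_le (min_le_right _ _)
    rwa [lt_div_iff₀ (norm_pos_iff.mpr ha₀)] at h1
  have hcρ : ‖c‖ < ρW := hcδ.trans_le hδρ
  have hs : coeffVector ℂ n d s' = b₀ + Pi.single m₀ c := by
    refine NodalPencil.coeffVector_eq_of_pointForm_eq i hf₁ ?_
    rw [hs', smul_smul]
  have hγ' : ∀ u : I, coeffVector ℂ n d (γ u) =
      b₀ + Pi.single m₀ (Complex.exp (((2 * π * (u : ℝ) : ℝ) : ℂ) * Complex.I) * c) := by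
    intro u
    refine NodalPencil.coeffVector_eq_of_pointForm_eq i hf₁ ?_
    rw [hγ u, smul_smul]
    congr 2
    rw [hc_def]; push_cast; ring_nf
  -- the member is compact
  have hXc : IsCompact (NodalPencil.pencilFibre n d i b₀ c) := NodalPencil.isCompact_pencilFibre_of_coeffVector_eq i b₀ hn hd hs
  -- the rescaling roots `λ_l^{a_l} = c` with `Σ|λ_l|² < T'`
  have hroot : ∀ l, ∃ w : ℂ, w ^ a l = c := fun l => IsAlgClosed.exists_pow_nat_eq c (Nat.pos_of_ne_zero (ha l))
  choose lam hlam using hroot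
  have hlamT : ∑ l, ‖lam l‖ ^ 2 < T' := by
    have hl : ∀ l, ‖lam l‖ ^ 2 < x₀ := by
      intro l
      have h1 : ‖lam l‖ ^ a l < x₀ ^ a l := by
        rw [← norm_pow, hlam l]
        exact lt_of_lt_of_le (hcδ.trans_le hδ₀x)
          (pow_le_pow_of_le_one hx₀0.le hx₀1 (Finset.single_le_sum (fun l _ => Nat.zero_le (a l)) (Finset.mem_univ l)))
      have h2 : ‖lam l‖ < x₀ := lt_of_pow_lt_pow_left₀ (a l) hx₀0.le h1
      have h3 : ‖lam l‖ ^ 2 < x₀ ^ 2 := by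
        have := norm_nonneg (lam l)
        nlinarith
      exact lt_of_lt_of_le h3 (by nlinarith)
    calc ∑ l, ‖lam l‖ ^ 2 < ∑ _l : Fin (n + 1), x₀ := Finset.sum_lt_sum_of_nonempty Finset.univ_nonempty fun l _ => hl l
      _ = (n + 1) * x₀ := by simp
      _ < T' := by
        rw [hx₀_def]
        have hn1 : (0 : ℝ) < n + 1 := by positivity
        field_simp
        nlinarith
  ------------------------------------------------------------------
  -- (9) the localisation datum on the member
  ------------------------------------------------------------------
  have h2π : Complex.exp (((2 * π * (1 : ℝ) : ℝ) : ℂ) * Complex.I) = 1 := by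
    rw [mul_one, show (((2 * π : ℝ)) : ℂ) * Complex.I = 2 * π * Complex.I by push_cast; ring]
    exact Complex.exp_two_pi_mul_I
  have h2π' : Complex.exp (((-(2 * π * (1 : ℝ)) : ℝ) : ℂ) * Complex.I) = 1 := by
    rw [mul_one, show (((-(2 * π) : ℝ)) : ℂ) * Complex.I = -(2 * π * Complex.I) by push_cast; ring, Complex.exp_neg,
      Complex.exp_two_pi_mul_I, inv_one]
  have hh₁c : Continuous fun x : {x : NodalPencil.pencilSlice n d i b₀ // NodalPencil.pencilCoord n d i b₀ x.1 ≠ 0} =>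
      h (1, x.1) := hhc.comp (continuous_const.prodMk continuous_id)
  have hh₁pc : ∀ x : NodalPencil.pencilSlice n d i b₀, NodalPencil.pencilCoord n d i b₀ x.1 ≠ 0 →
      ‖NodalPencil.pencilCoord n d i b₀ x.1‖ < δ₀ →
      NodalPencil.pencilCoord n d i b₀ (h (1, x)).1 = NodalPencil.pencilCoord n d i b₀ x.1 := fun x hx0 hxδ => by
    rw [(hhk 1 x hx0 hxδ).1, h2π, one_mul]
  have hh₁F : ∀ x : NodalPencil.pencilSlice n d i b₀, NodalPencil.pencilCoord n d i b₀ x.1 ≠ 0 →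
      ‖NodalPencil.pencilCoord n d i b₀ x.1‖ < δ₀ → NodalPencil.satRadius n d i Θ R''' R'' x.1 < T →
      NodalPencil.satRadius n d i Θ R''' R'' (h (1, x)).1 = NodalPencil.satRadius n d i Θ R''' R'' x.1 :=
    fun x hx0 hxδ hF => (hhk 1 x hx0 hxδ).2.1 hF
  have hh₁id : ∀ x : NodalPencil.pencilSlice n d i b₀, NodalPencil.pencilCoord n d i b₀ x.1 ≠ 0 →
      ‖NodalPencil.pencilCoord n d i b₀ x.1‖ < δ₀ → t₂ ≤ NodalPencil.satRadius n d i Θ R''' R'' x.1 → h (1, x) = x :=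
    fun x hx0 hxδ hF => hh1 x hx0 hxδ hF
  have hk₁h₁ : ∀ x : NodalPencil.pencilSlice n d i b₀, NodalPencil.pencilCoord n d i b₀ x.1 ≠ 0 →
      ‖NodalPencil.pencilCoord n d i b₀ x.1‖ < δ₀ → k (1, h (1, x)) = x := fun x hx0 hxδ => (hhk 1 x hx0 hxδ).2.2.2.1
  have hh₁k₁ : ∀ x : NodalPencil.pencilSlice n d i b₀, NodalPencil.pencilCoord n d i b₀ x.1 ≠ 0 →
      ‖NodalPencil.pencilCoord n d i b₀ x.1‖ < δ₀ → h (1, k (1, x)) = x := fun x hx0 hxδ => (hhk 1 x hx0 hxδ).2.2.2.2.1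
  have hk₁pc : ∀ x : NodalPencil.pencilSlice n d i b₀, NodalPencil.pencilCoord n d i b₀ x.1 ≠ 0 →
      ‖NodalPencil.pencilCoord n d i b₀ x.1‖ < δ₀ →
      NodalPencil.pencilCoord n d i b₀ (k (1, x)).1 = NodalPencil.pencilCoord n d i b₀ x.1 := fun x hx0 hxδ => by
    rw [(hhk 1 x hx0 hxδ).2.2.2.2.2.1, h2π', one_mul]
  have hH' : ∀ (s : ℝ) (x : NodalPencil.pencilSlice n d i b₀), NodalPencil.pencilCoord n d i b₀ x.1 ≠ 0 →
      ‖NodalPencil.pencilCoord n d i b₀ x.1‖ < δ₀ → NodalPencil.satRadius n d i Θ R''' R'' x.1 < T →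
      NodalPencil.pencilCoord n d i b₀ (H (s, x)).1 = NodalPencil.pencilCoord n d i b₀ x.1 ∧
      NodalPencil.satRadius n d i Θ R''' R'' (H (s, x)).1 = NodalPencil.satRadius n d i Θ R''' R'' x.1 ∧
      (H (0, x)).1 = chartModelIsotopy a Φ Θ (2 * π) x.1 ∧
      (NodalPencil.satRadius n d i Θ R''' R'' x.1 ≤ T' → H (1, x) = (fun x => h (1, x)) x) :=
    fun s x hx0 hxδ hF => hH s x hx0 hxδ hF
  obtain ⟨κ, κA, e, g, hκ, hκB, hκA, hbij, hg', hconj⟩ := WeightedPencil.exists_localisation_pencilFibre a ha hd' b₀ Φ hΦ hΦs hΦt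
    Θ hrt hΘ hR''t φ hφ hΘφ' hns hR hTR hTr ht₂T' hT'T hδρ (fun x => h (1, x)) (fun x => k (1, x)) hh₁c hh₁pc hh₁F hh₁id
    hk₁h₁ hh₁k₁ hk₁pc H hHc hH' hc0 hcδ hXc lam hlam hlamT
  -- the open cover of the member
  have hFc : Continuous (NodalPencil.satRadius n d i Θ R''' R'') := NodalPencil.continuous_satRadius n d i Θ R''' R'' hd' hΘ hR hR''t
  have hAo : IsOpen {Q : ↥(NodalPencil.pencilFibre n d i b₀ c) | NodalPencil.satRadius n d i Θ R''' R'' Q.1 < T'} :=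
    isOpen_lt (hFc.comp continuous_subtype_val) continuous_const
  have hBo : IsOpen {Q : ↥(NodalPencil.pencilFibre n d i b₀ c) | t₂ < NodalPencil.satRadius n d i Θ R''' R'' Q.1} :=
    isOpen_lt continuous_const (hFc.comp continuous_subtype_val)
  have hAB : {Q : ↥(NodalPencil.pencilFibre n d i b₀ c) | NodalPencil.satRadius n d i Θ R''' R'' Q.1 < T'} ∪
      {Q : ↥(NodalPencil.pencilFibre n d i b₀ c) | t₂ < NodalPencil.satRadius n d i Θ R''' R'' Q.1} = univ :=
    eq_univ_of_forall fun y => by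
      by_cases hy : NodalPencil.satRadius n d i Θ R''' R'' y.1 < T'
      · exact Or.inl hy
      · exact Or.inr (lt_of_lt_of_le ht₂T' (not_lt.mp hy))
  ------------------------------------------------------------------
  -- (10) the package on the projective fibre
  ------------------------------------------------------------------
  obtain ⟨A', B', hA'o, hB'o, hA'B', η', ηA, r', hηB, hηA, hconj', hT⟩ :=
    WeightedPencil.exists_localisationPackage_of_pencilMonodromy hn hd a b₀ h k hhc hh0
      (fun u x hx0 hxδ => by
        obtain ⟨hpc, -, -, hkh, hhk', hpk, -⟩ := hhk u x hx0 hxδ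
        exact ⟨hpc, hkh, hhk', hpk⟩)
      hc0 hcδ hs γ hγ' hAo hBo hAB κ hκ (fun y hy => hκB y hy) κA hκA e g hconj
  refine ⟨A', B', hA'o, hB'o, hA'B', η', ηA, e.comp (r' : C(↥A', _)), g, hηB, hηA, fun R M _ _ _ k' => ?_, hg', hconj', hT⟩
  rw [singularHomology.map_comp, ModuleCat.hom_comp, LinearMap.coe_comp]
  exact (hbij R M k').comp (singularHomology.mapIso R M r' k').toLinearEquiv.bijective

end WeightedPencil

end Literature.AlgebraicGeometry.HodgeTheory

end
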